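import Summits.Ventures.HodgeRepro2.T5SU11ResolventCommute
import Summits.Ventures.HodgeRepro2.T5SU11KernelCompositionDerivative

/-!
# The powers of the resolvents at two spectral points commute: `(G^I_λ)ᵐ (G^I_{λ₂})ⁿ = (G^I_{λ₂})ⁿ (G^I_λ)ᵐ`

Row 5xx's commutation `G^I_λ G^I_{λ₂} g = G^I_{λ₂} G^I_λ g` of the resolvents on the class (`T5SU11ResolventCommute.greenSolI_comm`),
transported to `W_1` (row 556) and iterated (the iterates stay in `W_1`, row 557; the resolvent sees the source on
`(0, ∞)` only, row 579):

* `greenSolI_comm_ground` — **`G^I_λ (G^I_{λ₂} g)(t) = G^I_{λ₂} (G^I_λ g)(t)`** for `g ∈ W_1`;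
* `greenSolI_iterate_comm`, `iterate_iterate_comm` — **`(G^I_λ)ᵐ (G^I_{λ₂})ⁿ g = (G^I_{λ₂})ⁿ (G^I_λ)ᵐ g` on `(0, ∞)`** for `g ∈ W_1`
  (the resolvents and their powers at any two spectral points commute).

Nothing is claimed about (N).

Blind lane: Mathlib + the HodgeRepro2 prefix only; no sorry; axioms ⊆ {propext, Classical.choice,
Quot.sound}.
-/

namespace Summit.Ventures.HodgeRepro2.T5SU11ResolventIterateCommute

open Filter Topology MeasureTheory
open Set (Ioi Ioc)
open T5SU11Cartan T5SU11SphericalFunction T5SU11SphericalDecay T5SU11RadialGreenImproper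
  T5SU11ResolventCommute T5SU11ResolventGroundStateWeight T5SU11WeightedSpaceGroundState
  T5SU11KernelCompositionDerivative

section measure

variable [MeasurableSpace Circle] [BorelSpace Circle]

variable {lam lam₂ : ℝ} (hlam : 1 < lam) (hlam₂ : 1 < lam₂)

section ground_state

variable {g : ℝ → ℝ} (hg : ContinuousOn g (Ioi 0)) {D : ℝ} (hD : ∀ s, 0 < s → |g s| ≤ D * sph 1 (hyp s))

include hlam hlam₂ hg hD in
/-- The resolvents commute on `W_1`: `G^I_λ (G^I_{λ₂} g)(t) = G^I_{λ₂} (G^I_λ g)(t)` for `t > 0`. -/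
theorem greenSolI_comm_ground {t : ℝ} (ht : 0 < t) :
    greenSolI (fun t => sph lam (hyp t)) (sphDecay lam)
        (greenSolI (fun t => sph lam₂ (hyp t)) (sphDecay lam₂) g) t
      = greenSolI (fun t => sph lam₂ (hyp t)) (sphDecay lam₂)
        (greenSolI (fun t => sph lam (hyp t)) (sphDecay lam) g) t := by
  have hmin : 1 < min lam lam₂ := lt_min hlam hlam₂
  obtain ⟨hM, hD0, _, C, hC⟩ := class_of_le_mul_sph_one hmin hD
  have hε₁ : 2 - lam < (3 - min lam lam₂) / 2 := by linarith [min_le_left lam lam₂]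
  have hε₂ : 2 - lam₂ < (3 - min lam lam₂) / 2 := by linarith [min_le_right lam lam₂]
  exact greenSolI_comm hlam hlam₂ hg hM hD0 hε₁ hε₂ hC ht

include hlam hlam₂ hg hD in
/-- **`G^I_λ (G^I_{λ₂})ⁿ g = (G^I_{λ₂})ⁿ G^I_λ g` on `(0, ∞)`** for `g ∈ W_1`. -/
theorem greenSolI_iterate_comm (n : ℕ) :
    ∀ t, 0 < t →
      greenSolI (fun t => sph lam (hyp t)) (sphDecay lam)
          ((greenSolI (fun t => sph lam₂ (hyp t)) (sphDecay lam₂))^[n] g) t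
        = ((greenSolI (fun t => sph lam₂ (hyp t)) (sphDecay lam₂))^[n]
          (greenSolI (fun t => sph lam (hyp t)) (sphDecay lam) g)) t := by
  induction n with
  | zero => intro t _; rfl
  | succ n ih =>
    intro t ht
    -- `(G^I_{λ₂})ⁿ g ∈ W_1` (row 557)
    obtain ⟨hc, hb⟩ := iterate_mem_weighted_one hlam₂ hg hD n
    have hb' : ∀ s, 0 < s → |((greenSolI (fun t => sph lam₂ (hyp t)) (sphDecay lam₂))^[n] g) s|
        ≤ D / ((lam₂ - 1) ^ 2) ^ n * sph 1 (hyp s) := by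
      intro s hs
      rw [div_mul_eq_mul_div]
      exact hb s hs
    rw [Function.iterate_succ_apply', greenSolI_comm_ground hlam hlam₂ hc hb' ht, Function.iterate_succ_apply']
    exact greenSolI_congr_Ioi (fun t => sph lam₂ (hyp t)) (sphDecay lam₂) ih ht

include hlam hlam₂ hg hD in
/-- **THE POWERS OF THE RESOLVENTS AT TWO SPECTRAL POINTS COMMUTE**: `(G^I_λ)ᵐ (G^I_{λ₂})ⁿ g = (G^I_{λ₂})ⁿ (G^I_λ)ᵐ g` on
`(0, ∞)` for `g ∈ W_1`. -/
theorem iterate_iterate_comm (m n : ℕ) :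
    ∀ t, 0 < t →
      ((greenSolI (fun t => sph lam (hyp t)) (sphDecay lam))^[m]
          ((greenSolI (fun t => sph lam₂ (hyp t)) (sphDecay lam₂))^[n] g)) t
        = ((greenSolI (fun t => sph lam₂ (hyp t)) (sphDecay lam₂))^[n]
          ((greenSolI (fun t => sph lam (hyp t)) (sphDecay lam))^[m] g)) t := by
  induction m with
  | zero => intro t _; rfl
  | succ m ih =>
    intro t ht
    -- `(G^I_λ)ᵐ g ∈ W_1` (row 557)
    obtain ⟨hc, hb⟩ := iterate_mem_weighted_one hlam hg hD m
    have hb' : ∀ s, 0 < s → |((greenSolI (fun t => sph lam (hyp t)) (sphDecay lam))^[m] g) s|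
        ≤ D / ((lam - 1) ^ 2) ^ m * sph 1 (hyp s) := by
      intro s hs
      rw [div_mul_eq_mul_div]
      exact hb s hs
    rw [Function.iterate_succ_apply', greenSolI_congr_Ioi (fun t => sph lam (hyp t)) (sphDecay lam) ih ht,
      greenSolI_iterate_comm hlam hlam₂ hc hb' n t ht,
      Function.iterate_succ_apply' (greenSolI (fun t => sph lam (hyp t)) (sphDecay lam)) m g]

end ground_state

end measure

end Summit.Ventures.HodgeRepro2.T5SU11ResolventIterateCommute
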